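import Summits.ABC.IUTFork.Cor312GenuineKWildExactTriple
import Summits.ABC.IUTFork.Cor312GenuineKWildDifferentExact
import HarnessLib

/-!
# [IUTchIII] Cor. 3.12, branch C / R-W window table — the EXACT wild different at `p ∈ {3, 5}` READ OFF AN abc TRIPLE:
# W1 `d = (2e − 1)/e`, W2 `d = (e + e/p − 1)/e`, SPLIT `d = (e − 1)/e`, from `(a, b, c, p, v)` and ONE integer divisibility

PROOF-ONLY support file (D-0012; 0 definitions, 0 `Prop` facts) of the abc-iut cell (R-W «WINDOW Θ-SIDE INEQUALITY», seat abc-iut-w5-d180 gen 10;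
instantiation layer of rows «W:HENSEL-DIFFERENT-LOCAL» / «W:W2-DIFFERENT-EXACT» for the refuted-band and pinned-row seats working from abc triples).
TAKES NO SIDE on [IUTchIII] Cor. 3.12 (S. Mochizuki, *Inter-universal Teichmüller theory III*, Cor. 3.12 p. 173–174) or on any author.

For an abc triple `a + b = c` with Legendre/Frey point `λ = a/c`, an odd prime `p ∈ {3, 5}` with `p^v ∥ abc` (`v ≥ 1`; pole order of `j(λ)` at `p`
is exactly `2v`, abc-iut-W-neg-1 / abc-iut-w5-d236's `RadTriple.ord_jInv_eq_neg_two_mul`), `p ≠ l`, and the INTEGER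
`D = ((abc/p^v)²)^{p−1} − (2⁸(cb + a²)³)^{p−1}` (abc-iut-W-neg-1's `Cor312GenuineKWildExactTriple`: `RadTriple.unit_test_of_dvd_of_not_sq_dvd`,
`RadTriple.split_test_of_sq_dvd`), at EVERY fibre point `x₀ ∣ p` of the pilot datum of a genuine Θ-volume datum at `(ratPoint (a/c), l)`:

* **`GenuineK.differentOrd_kOf_eq_wild_of_triple`** — W1 (`p ∤ v`): `d(K_{x₀}) = (2e − 1)/e`;
* **`GenuineK.differentOrd_kOf_eq_wildUnit_of_triple`** — W2 (`p ∣ v`, `p ∣ D`, `p² ∤ D`): `d(K_{x₀}) = (e + e/p − 1)/e`;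
* **`GenuineK.differentOrd_kOf_eq_wildSplit_of_triple`** — SPLIT (`p ∣ v`, `p² ∣ D`): `p ∤ e` and `d(K_{x₀}) = (e − 1)/e`.

(The exact `e` itself per case is W-neg-1's `GenuineK.absRamificationIdx_kOf_eq_wild{,Unit,Split}_of_triple`.) HONEST FRAMING: bookkeeping over OUR typed
objects; nothing here bears on the printed inequality of [IUTchIII] Cor. 3.12 or on the number-level `Cor22.Cor312AtDatum`; typed ≠ proved; instantiated ≠
endorsed; no abc claim. [cite: SerreLocalFields1979, Ch. III §6 Prop. 13] [cite: Serre1973, Ch. II §3.3]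
[cite: Mochizuki2012, IUTchIV Prop. 1.3 (i) p. 11, Thm. 1.10 p. 22; Cor. 2.2 (ii) proof p. 44] [claim: Mochizuki2012, status: disputed] for every IUT quotation.
-/

noncomputable section

open NumberField IsDedekindDomain

namespace Summit.ABC.IUTFork.Conditional

open Thm311 Thm311.Real Cor312 Cor312Prov Literature.IUT.LogVolume Literature.IUT.HodgeTheaters
  Literature.IUT.LogThetaLattice Literature.NumberTheory.NumberFields Literature.NumberTheory.DiophantineGeometry.GenEll
  Literature.NumberTheory.DiophantineGeometry Literature.NumberTheory.EllipticCurves Summit.ABC.ABC.Theorems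

section Triple

variable {a b c : ℕ} (habc : IsABCTriple a b c) {l : ℕ} (T : Cor22.ThetaVolumeDatumAt (ratPoint ((a : ℚ) / c)) l)
  (pp : Nat.Primes) {p' : ℕ} (hpq : ((pp : ℕ) = 3 ∧ p' = 5) ∨ ((pp : ℕ) = 5 ∧ p' = 3)) (hpl : (pp : ℕ) ≠ l)
  {v : ℕ} (hv : 1 ≤ v) (hdvd : (pp : ℕ) ^ v ∣ a * b * c) (hndvd : ¬ (pp : ℕ) ^ (v + 1) ∣ a * b * c)

include habc hpq hpl hv hdvd hndvd in
/-- **W1 at an abc triple: `p ∤ v ⇒ d(K_{x₀}) = (2e − 1)/e`** at every fibre point `x₀ ∣ p ∈ {3,5}` (`p ≠ l`, `p^v ∥ abc`) of the pilot datum of a genuine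
Θ-volume datum at `(ratPoint (a/c), l)` (`GenuineK.differentOrd_kOf_eq_wild_ratPoint` + `RadTriple.ord_jInv_eq_neg_two_mul`).
[cite: SerreLocalFields1979, Ch. III §6 Prop. 13] [cite: Mochizuki2012, IUTchIV Thm. 1.10 p. 22] [claim: Mochizuki2012, status: disputed] -/
theorem GenuineK.differentOrd_kOf_eq_wild_of_triple (hpt : ¬ (pp : ℕ) ∣ v) :
    letI := T.instFieldF; letI := T.instNumberFieldF; letI := T.instAlgebraF; letI := T.instFieldK
    letI := T.instNumberFieldK; letI := T.instAlgebraK; letI := T.instFieldFbar; letI := T.instAlgebraFbar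
    letI := T.instAlgebraKFbar; letI := T.instIsElliptic
    haveI : Fact (pp : ℕ).Prime := ⟨pp.2⟩
    ∀ x₀ : (thetaIndex (pilotDataOfK T.D T.K)).Fibre (.inr pp),
      differentOrd (pp : ℕ) (kOf (pilotDataOfK T.D T.K) pp.1 x₀) =
        ((2 * absRamificationIdx (pp : ℕ) (kOf (pilotDataOfK T.D T.K) pp.1 x₀) - 1 : ℕ) : ℝ) /
          (absRamificationIdx (pp : ℕ) (kOf (pilotDataOfK T.D T.K) pp.1 x₀) : ℝ) := by
  have hp2 : (pp : ℕ) ≠ 2 := by rcases hpq with ⟨h, -⟩ | ⟨h, -⟩ <;> omega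
  exact GenuineK.differentOrd_kOf_eq_wild_ratPoint T pp hpq hpl hv hpt
    (RadTriple.ord_jInv_eq_neg_two_mul habc pp.2 hp2 hv hdvd hndvd)

include habc hpq hpl hv hdvd hndvd in
/-- **W2 at an abc triple: `p ∣ v`, `p ∣ D`, `p² ∤ D ⇒ d(K_{x₀}) = (e + e/p − 1)/e`**, `D = ((abc/p^v)²)^{p−1} − (2⁸(cb+a²)³)^{p−1}`
(`GenuineK.differentOrd_kOf_eq_wildUnit_ratPoint` + `RadTriple.unit_test_of_dvd_of_not_sq_dvd`). [cite: SerreLocalFields1979, Ch. III §6 Prop. 13]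
[cite: Serre1973, Ch. II §3.3] [cite: Mochizuki2012, IUTchIV Prop. 1.3 (i) p. 11, Thm. 1.10 p. 22] [claim: Mochizuki2012, status: disputed] -/
theorem GenuineK.differentOrd_kOf_eq_wildUnit_of_triple (hpt : (pp : ℕ) ∣ v)
    (hD1 : ((pp : ℕ) : ℤ) ∣ (((a * b * c / (pp : ℕ) ^ v : ℕ) : ℤ) ^ 2) ^ ((pp : ℕ) - 1) - ((256 * (c * b + a * a) ^ 3 : ℕ) : ℤ) ^ ((pp : ℕ) - 1))
    (hD2 : ¬ (((pp : ℕ) : ℤ) ^ 2) ∣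
      (((a * b * c / (pp : ℕ) ^ v : ℕ) : ℤ) ^ 2) ^ ((pp : ℕ) - 1) - ((256 * (c * b + a * a) ^ 3 : ℕ) : ℤ) ^ ((pp : ℕ) - 1)) :
    letI := T.instFieldF; letI := T.instNumberFieldF; letI := T.instAlgebraF; letI := T.instFieldK
    letI := T.instNumberFieldK; letI := T.instAlgebraK; letI := T.instFieldFbar; letI := T.instAlgebraFbar
    letI := T.instAlgebraKFbar; letI := T.instIsElliptic
    haveI : Fact (pp : ℕ).Prime := ⟨pp.2⟩
    ∀ x₀ : (thetaIndex (pilotDataOfK T.D T.K)).Fibre (.inr pp),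
      differentOrd (pp : ℕ) (kOf (pilotDataOfK T.D T.K) pp.1 x₀) =
        ((absRamificationIdx (pp : ℕ) (kOf (pilotDataOfK T.D T.K) pp.1 x₀) +
              absRamificationIdx (pp : ℕ) (kOf (pilotDataOfK T.D T.K) pp.1 x₀) / pp - 1 : ℕ) : ℝ) /
          (absRamificationIdx (pp : ℕ) (kOf (pilotDataOfK T.D T.K) pp.1 x₀) : ℝ) := by
  have hp2 : (pp : ℕ) ≠ 2 := by rcases hpq with ⟨h, -⟩ | ⟨h, -⟩ <;> omega
  exact GenuineK.differentOrd_kOf_eq_wildUnit_ratPoint T pp hpq hpl hv hpt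
    (RadTriple.ord_jInv_eq_neg_two_mul habc pp.2 hp2 hv hdvd hndvd)
    (RadTriple.unit_test_of_dvd_of_not_sq_dvd habc pp.2 hp2 hv hdvd hD1 hD2)

include habc hpq hpl hv hdvd hndvd in
/-- **SPLIT at an abc triple: `p ∣ v`, `p² ∣ D ⇒ p ∤ e(K_{x₀}/ℚ_p)` and `d(K_{x₀}) = (e − 1)/e`**, `D = ((abc/p^v)²)^{p−1} − (2⁸(cb+a²)³)^{p−1}`
(`GenuineK.differentOrd_kOf_eq_wildSplit_ratPoint` + `RadTriple.split_test_of_sq_dvd`). E.g. `7³29⁵151² + 2⁴5¹⁶97·919 = 3²⁷13⁴` at `3` (`v = 27`):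
tame, `d = 1 − 1/e`. [cite: SerreLocalFields1979, Ch. III §6 Prop. 13] [cite: Serre1973, Ch. II §3.3] [cite: Mochizuki2012, IUTchIV Thm. 1.10 p. 22]
[claim: Mochizuki2012, status: disputed] -/
theorem GenuineK.differentOrd_kOf_eq_wildSplit_of_triple (hpt : (pp : ℕ) ∣ v)
    (hD : (((pp : ℕ) : ℤ) ^ 2) ∣
      (((a * b * c / (pp : ℕ) ^ v : ℕ) : ℤ) ^ 2) ^ ((pp : ℕ) - 1) - ((256 * (c * b + a * a) ^ 3 : ℕ) : ℤ) ^ ((pp : ℕ) - 1)) :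
    letI := T.instFieldF; letI := T.instNumberFieldF; letI := T.instAlgebraF; letI := T.instFieldK
    letI := T.instNumberFieldK; letI := T.instAlgebraK; letI := T.instFieldFbar; letI := T.instAlgebraFbar
    letI := T.instAlgebraKFbar; letI := T.instIsElliptic
    haveI : Fact (pp : ℕ).Prime := ⟨pp.2⟩
    ∀ x₀ : (thetaIndex (pilotDataOfK T.D T.K)).Fibre (.inr pp),
      ¬ (pp : ℕ) ∣ absRamificationIdx (pp : ℕ) (kOf (pilotDataOfK T.D T.K) pp.1 x₀) ∧
      differentOrd (pp : ℕ) (kOf (pilotDataOfK T.D T.K) pp.1 x₀) =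
        ((absRamificationIdx (pp : ℕ) (kOf (pilotDataOfK T.D T.K) pp.1 x₀) : ℝ) - 1) /
          (absRamificationIdx (pp : ℕ) (kOf (pilotDataOfK T.D T.K) pp.1 x₀) : ℝ) := by
  have hp2 : (pp : ℕ) ≠ 2 := by rcases hpq with ⟨h, -⟩ | ⟨h, -⟩ <;> omega
  exact GenuineK.differentOrd_kOf_eq_wildSplit_ratPoint T pp hpq hpl hv hpt
    (RadTriple.ord_jInv_eq_neg_two_mul habc pp.2 hp2 hv hdvd hndvd)
    (RadTriple.split_test_of_sq_dvd habc pp.2 hp2 hv hdvd hD)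

end Triple

end Summit.ABC.IUTFork.Conditional

end
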